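import Mathlib
import Literature.Probability.LatticeModels.TemperleyLiebBaxterization
import Literature.Probability.LatticeModels.TemperleyLiebConnectivityBasis
import Literature.Probability.Percolation.DiagonalColumnPatterns
import Literature.Probability.Percolation.DiagonalStripTransferInhomogeneous
import Literature.Probability.Percolation.DiagonalStripTransferInterlacingTwoRow
import Literature.Probability.Percolation.DiagonalStripGenericRapidities
import Literature.Probability.Percolation.DiagonalStripGenericSwap
import Literature.Probability.Percolation.DiagonalStripGenericInversion
import Literature.Probability.Percolation.DiagonalStripGroundStateQKZ
import Literature.Probability.Percolation.DiagonalStripGroundStateNC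
import HarnessLib

/-!
# The rank-one cocycle identities of the ground-state scalars

Topic `Literature/Probability/Percolation`. For the generic ground state `Ψ` of Ikhlef–Ponsaing's
transfer matrix (J. Stat. Phys. 149 (2012), arXiv:1202.5476, §3.4) the exchange and reflection
equations hold up to scalars `c_i`, `d` (`DiagonalStripGroundStateQKZ.lean`,
`DiagonalStripGroundStateNC.lean`). IP12's normalisation claim ("with this normalisation the
interlacing relations yield the qKZ equation `ŘΨ = π_iΨ`, `Ψ(1/z_1,…) = Ψ`") amounts to these
scalars forming a coboundary. This file proves the rank-one pieces of the cocycle condition, which is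
what unitarity and involutivity give: `genSwap_genSwap`, `genInv_genInv` (the swaps and inversions
are involutions), **`reflect_scalar_cocycle`** (`d · genInv(d) = 1`), **`exchange_scalar_cocycle`**
(`c σ_i(c) = [q/x][qx]` from `tlConn_unitarity`), and their instances for the ground state
(`ncGroundState_exchange_scalar_cocycle_odd/_even`, `groundState_reflect_scalar_cocycle`).

## References

* Y. Ikhlef, A. K. Ponsaing, J. Stat. Phys. 149 (2012) 10–36, arXiv:1202.5476, Lemma 3.1, §3.4.
  [IkhlefPonsaing2012]
-/

namespace Literature.Probability.Percolation

open Literature.Probability.LatticeModels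

variable {m : ℕ}

/-! ### The rank-one cocycle identities of the scalars -/

section Cocycle

open MvPolynomial Literature.Probability.LatticeModels.TemperleyLieb

variable {K₀ : Type*} [Field K₀]

/-- **The swap automorphisms are involutions.** [folklore] -/
theorem genSwap_genSwap (i : ℕ) (x : RapidityField K₀) : genSwap K₀ i (genSwap K₀ i x) = x := by
  have h : (genSwap K₀ i).toRingHom.comp (genSwap K₀ i).toRingHom = RingHom.id _ := by
    refine IsFractionRing.ringHom_ext (A := MvPolynomial ℕ K₀) (fun P => ?_)
    simp only [RingHom.comp_apply, RingHom.id_apply, RingEquiv.toRingHom_eq_coe, RingEquiv.coe_toRingHom]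
    show genSwap K₀ i (genSwap K₀ i (toRF K₀ P)) = toRF K₀ P
    rw [genSwap_toRF, genSwap_toRF, rename_rename]
    have hss : (⇑(Equiv.swap i (i + 1)) ∘ ⇑(Equiv.swap i (i + 1))) = id :=
      funext fun n => Equiv.swap_apply_self _ _ _
    rw [hss, rename_id, AlgHom.id_apply]
  exact DFunLike.congr_fun h x

/-- **The inversion endomorphisms are involutions.** [folklore] -/
theorem genInv_genInv (k : ℕ) (x : RapidityField K₀) : genInv K₀ k (genInv K₀ k x) = x := by
  have hz : genZ K₀ k ≠ 0 := genZ_ne_zero k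
  have h1 : (genInv K₀ k).comp (invSubst K₀ k) = toRF K₀ := by
    refine ringHom_ext (fun r => ?_) (fun n => ?_)
    · rw [RingHom.comp_apply, show invSubst K₀ k (C r) = genC K₀ r from by
        rw [invSubst, eval₂Hom_C, RingHom.comp_apply]; rfl, genInv_genC]; rfl
    · rw [RingHom.comp_apply, invSubst, eval₂Hom_X']
      by_cases hn : n = k
      · subst hn
        rw [if_pos rfl, map_inv₀, genInv_genZ, Function.update_self, inv_inv]; rfl
      · rw [if_neg hn, genInv_genZ, Function.update_of_ne hn]; rfl
  have h : (genInv K₀ k).comp (genInv K₀ k) = RingHom.id _ := by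
    refine IsFractionRing.ringHom_ext (A := MvPolynomial ℕ K₀) (fun P => ?_)
    rw [RingHom.comp_apply, RingHom.id_apply]
    show genInv K₀ k (genInv K₀ k (toRF K₀ P)) = toRF K₀ P
    rw [genInv_toRF, ← RingHom.comp_apply (genInv K₀ k) (invSubst K₀ k), h1]
  exact DFunLike.congr_fun h x

/-- **Cocycle identity of a reflection scalar**: if `genInv k Ψ = d Ψ` for a nonzero `Ψ` then
`d · genInv k (d) = 1`. [cite: IkhlefPonsaing2012, §3.4] -/
theorem reflect_scalar_cocycle (k : ℕ) {ψ : ColPattern m → RapidityField K₀} (hψ0 : ψ ≠ 0) {d : RapidityField K₀}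
    (hd : ∀ Q, genInv K₀ k (ψ Q) = d * ψ Q) : d * genInv K₀ k d = 1 := by
  obtain ⟨Q, hQ⟩ : ∃ Q, ψ Q ≠ 0 := by
    by_contra h; simp only [not_exists, not_not] at h; exact hψ0 (funext h)
  have h2 := congrArg (genInv K₀ k) (hd Q)
  rw [genInv_genInv, map_mul, hd Q, ← mul_assoc, mul_comm (genInv K₀ k d)] at h2
  -- `ψ Q = (d * genInv d) * ψ Q`
  have := mul_right_cancel₀ hQ (h2.symm.trans (one_mul (ψ Q)).symm)
  exact this

/-- The swap acts on the generators' fibers sums componentwise. [folklore] -/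
theorem genSwap_tlConn_apply (i : ℕ) (k : Fin (2 * m)) (v : NCState (m + 1) → RapidityField K₀) (s : NCState (m + 1)) :
    genSwap K₀ i ((tlConn m (RapidityField K₀) k (ncFinsupp v)) s) =
      (tlConn m (RapidityField K₀) k (ncFinsupp (fun s => genSwap K₀ i (v s)))) s := by
  rw [tlConn_apply, tlConn_apply, map_sum]
  rfl

/-- The swap commutes with `[·]`. [folklore] -/
theorem genSwap_qbr (i : ℕ) (x : RapidityField K₀) : genSwap K₀ i (qbr x) = qbr (genSwap K₀ i x) := by
  unfold qbr; rw [map_sub, map_inv₀]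

/-- The swap on an `Ř`-numerator component. [folklore] -/
theorem genSwap_tlRnum_tlConn_apply (i : ℕ) (q : K₀) (w : RapidityField K₀) (k : Fin (2 * m))
    (v : NCState (m + 1) → RapidityField K₀) (s : NCState (m + 1)) :
    genSwap K₀ i ((tlRnum (genC K₀ q) w (tlConn m (RapidityField K₀) k) (ncFinsupp v)) s) =
      (tlRnum (genC K₀ q) (genSwap K₀ i w) (tlConn m (RapidityField K₀) k)
        (ncFinsupp (fun s => genSwap K₀ i (v s)))) s := by
  rw [tlRnum_tlConn_apply, tlRnum_tlConn_apply, map_sub, map_mul, map_mul, genSwap_qbr, genSwap_qbr, map_div₀,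
    genSwap_genC, ← tlConn_apply, ← tlConn_apply, genSwap_tlConn_apply]
  rfl

/-- **Cocycle identity of an exchange scalar** (from unitarity `Ř(x)Ř(1/x) = [q/x][qx]`): if
`(tlRnum q x (e_k)) Ψ = c · σ_i Ψ` componentwise with `σ_i(x) = x⁻¹`, `Ψ ≠ 0`, then
`c · σ_i(c) = [q/x] [q x]`, i.e. `c̃ σ_i(c̃) = 1` for `c̃ = c/[qx]`. [cite: IkhlefPonsaing2012, §3.4] -/
theorem exchange_scalar_cocycle {q : K₀} (hq : q ^ 2 + q + 1 = 0) (i : ℕ) (k : Fin (2 * m))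
    {x : RapidityField K₀} (hx : x ≠ 0) (hσx : genSwap K₀ i x = x⁻¹)
    {v : NCState (m + 1) → RapidityField K₀} (hv0 : v ≠ 0) {c : RapidityField K₀}
    (hc : ∀ s, (tlRnum (genC K₀ q) x (tlConn m (RapidityField K₀) k) (ncFinsupp v)) s = c * genSwap K₀ i (v s)) :
    c * genSwap K₀ i c = qbr (genC K₀ q / x) * qbr (genC K₀ q * x) := by
  set σv : NCState (m + 1) → RapidityField K₀ := fun s => genSwap K₀ i (v s) with hσv
  -- apply `σ` to the exchange equation: `(tlRnum q x⁻¹ e) (σv) = σ(c) v` componentwise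
  have h1 : ∀ s, (tlRnum (genC K₀ q) x⁻¹ (tlConn m (RapidityField K₀) k) (ncFinsupp σv)) s = genSwap K₀ i c * v s := by
    intro s
    have := congrArg (genSwap K₀ i) (hc s)
    rw [genSwap_tlRnum_tlConn_apply, hσx, map_mul, genSwap_genSwap] at this
    exact this
  -- as vectors
  have h1v : tlRnum (genC K₀ q) x⁻¹ (tlConn m (RapidityField K₀) k) (ncFinsupp σv) = genSwap K₀ i c • ncFinsupp v := by
    ext s; rw [h1 s, Finsupp.smul_apply, smul_eq_mul, ncFinsupp_apply]
  have hcv : tlRnum (genC K₀ q) x (tlConn m (RapidityField K₀) k) (ncFinsupp v) = c • ncFinsupp σv := by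
    ext s; rw [hc s, Finsupp.smul_apply, smul_eq_mul, ncFinsupp_apply]
  -- unitarity applied to `σv`
  have hU := tlConn_unitarity m (K := RapidityField K₀) (genC_quad hq) hx k
  have happ := congrArg (fun T : Module.End (RapidityField K₀) (NCState (m + 1) →₀ RapidityField K₀) => T (ncFinsupp σv)) hU
  simp only [Module.End.mul_apply, Module.algebraMap_end_apply] at happ
  rw [h1v, LinearMap.map_smul, hcv, smul_smul] at happ
  -- compare coefficients at a state where `σv ≠ 0`
  obtain ⟨s, hs⟩ : ∃ s, σv s ≠ 0 := by
    by_contra h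
    simp only [not_exists, not_not] at h
    apply hv0
    funext s
    have := h s
    simp only [hσv] at this
    have h' := congrArg (genSwap K₀ i) this
    rwa [genSwap_genSwap, map_zero] at h'
  have := congrArg (fun f : NCState (m + 1) →₀ RapidityField K₀ => f s) happ
  simp only [Finsupp.smul_apply, smul_eq_mul, ncFinsupp_apply] at this
  rw [mul_comm (genSwap K₀ i c) c] at this
  exact mul_right_cancel₀ hs this

/-- **For the generic ground state**: the odd-level exchange scalar `c` of
`ncGroundState_tlRnum_odd_upToScalar` satisfies `c σ_i(c) = [q z_{i+1}/z_i][q z_i/z_{i+1}]`.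
[cite: IkhlefPonsaing2012, §3.4] -/
theorem ncGroundState_exchange_scalar_cocycle_odd {q : ℂ} (hq : q ^ 2 + q + 1 = 0)
    {ψ : ColPattern m → RapidityField ℂ}
    (hψ : ∀ Q', ∑ Q, ipTransferMatrixW m (genC ℂ q) (genW ℂ) (genZ ℂ) Q Q' * ψ Q = ψ Q') (hψ0 : ψ ≠ 0)
    (j' : Fin m) {c : RapidityField ℂ}
    (hc : ∀ s : NCState (m + 1),
      (tlRnum (genC ℂ q) (genZ ℂ (2 * j' + 1) / genZ ℂ (2 * j' + 2))
          (tlConn m (RapidityField ℂ) ⟨2 * j', by omega⟩) (ncFinsupp (ncVec ψ))) s =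
        c * genSwap ℂ (2 * j' + 1) (ncVec ψ s)) :
    c * genSwap ℂ (2 * j' + 1) c =
      qbr (genC ℂ q / (genZ ℂ (2 * j' + 1) / genZ ℂ (2 * j' + 2))) *
        qbr (genC ℂ q * (genZ ℂ (2 * j' + 1) / genZ ℂ (2 * j' + 2))) := by
  refine exchange_scalar_cocycle hq (2 * j' + 1) ⟨2 * j', by omega⟩
    (div_ne_zero (genZ_ne_zero _) (genZ_ne_zero _)) ?_ (ncVec_ne_zero hq hψ hψ0) hc
  rw [map_div₀, genSwap_genZ, genSwap_genZ, zswap_self, show 2 * (j' : ℕ) + 2 = 2 * j' + 1 + 1 from rfl,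
    zswap_succ, inv_div]

/-- The same at even levels. [cite: IkhlefPonsaing2012, §3.4] -/
theorem ncGroundState_exchange_scalar_cocycle_even {q : ℂ} (hq : q ^ 2 + q + 1 = 0)
    {ψ : ColPattern m → RapidityField ℂ}
    (hψ : ∀ Q', ∑ Q, ipTransferMatrixW m (genC ℂ q) (genW ℂ) (genZ ℂ) Q Q' * ψ Q = ψ Q') (hψ0 : ψ ≠ 0)
    (b0 : Fin m) {c : RapidityField ℂ}
    (hc : ∀ s : NCState (m + 1),
      (tlRnum (genC ℂ q) (genZ ℂ (2 * b0 + 2) / genZ ℂ (2 * b0 + 3))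
          (tlConn m (RapidityField ℂ) ⟨2 * b0 + 1, by omega⟩) (ncFinsupp (ncVec ψ))) s =
        c * genSwap ℂ (2 * b0 + 2) (ncVec ψ s)) :
    c * genSwap ℂ (2 * b0 + 2) c =
      qbr (genC ℂ q / (genZ ℂ (2 * b0 + 2) / genZ ℂ (2 * b0 + 3))) *
        qbr (genC ℂ q * (genZ ℂ (2 * b0 + 2) / genZ ℂ (2 * b0 + 3))) := by
  refine exchange_scalar_cocycle hq (2 * b0 + 2) ⟨2 * b0 + 1, by omega⟩
    (div_ne_zero (genZ_ne_zero _) (genZ_ne_zero _)) ?_ (ncVec_ne_zero hq hψ hψ0) hc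
  rw [map_div₀, genSwap_genZ, genSwap_genZ, zswap_self, show 2 * (b0 : ℕ) + 3 = 2 * b0 + 2 + 1 from rfl,
    zswap_succ, inv_div]

/-- **For the generic ground state**: the reflection scalars satisfy `d · genInv(d) = 1`.
[cite: IkhlefPonsaing2012, §3.4] -/
theorem groundState_reflect_scalar_cocycle {q : ℂ} (hq : q ^ 2 + q + 1 = 0)
    {ψ : ColPattern m → RapidityField ℂ}
    (hψ : ∀ Q', ∑ Q, ipTransferMatrixW m (genC ℂ q) (genW ℂ) (genZ ℂ) Q Q' * ψ Q = ψ Q') (hψ0 : ψ ≠ 0) :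
    (∃ d : RapidityField ℂ, (∀ Q, genInv ℂ 1 (ψ Q) = d * ψ Q) ∧ d * genInv ℂ 1 d = 1) ∧
      ∃ d : RapidityField ℂ, (∀ Q, genInv ℂ (2 * m + 1) (ψ Q) = d * ψ Q) ∧ d * genInv ℂ (2 * m + 1) d = 1 := by
  obtain ⟨⟨d₁, hd₁⟩, ⟨d₂, hd₂⟩⟩ := groundState_reflect_upToScalar hq hψ hψ0
  exact ⟨⟨d₁, hd₁, reflect_scalar_cocycle 1 hψ0 hd₁⟩, ⟨d₂, hd₂, reflect_scalar_cocycle (2 * m + 1) hψ0 hd₂⟩⟩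

end Cocycle

end Literature.Probability.Percolation
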